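import Literature.Computability.AlgebraicComplexity.SymmetricArithCircuit
import Literature.Computability.AlgebraicComplexity.ArithCircuit
import Literature.Computability.AlgebraicComplexity.SupportSymmetrisation
import Literature.Computability.AlgebraicComplexity.TrivialAction
import HarnessLib

/-!
# Straight-line programs as labelled circuits, I: the circuit

Topic `Computability/AlgebraicComplexity`, namespace `Literature.Computability.AlgebraicComplexity`.

The tree has two renderings of arithmetic circuits:

* `ArithCircuit K σ` (`ArithCircuit.lean`; Bürgisser 2000, Def. 2.1): a straight-line
  program, a LIST of unbounded fan-in weighted-sum gates `∑ cₜ • uₜ` and product gates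
  `∏ uₜ` over operands `var x | const c | gate j`, with the TOTAL list semantics `gateValues`
  (gate `i` is evaluated against the values of the gates `0, …, i-1` only; a forward or
  dangling reference `gate j` reads the junk value `0`) and
  `P.eval = P.output.eval (gateValues P.gates)`; this is the currency of `complexity`,
  `circuitSize`, `IsVPFamily`;
* `LabelledArithCircuit K X Y G` (`SymmetricArithCircuit.lean`; Dawar–Wilsenach 2025,
  Def. 2.2): a labelled DAG on a gate type `G` whose `+`/`×` gates take the UNWEIGHTED
  sum/product over a SET of children — the setting of symmetric circuits (Defs. 3.6, 3.7).

This file builds, for a program `P : ArithCircuit K σ`, the labelled circuit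
`ArithCircuit.Labelled.progCircuit P` over the variables `TrivAct σ` (the same variables, on
which every group acts trivially, `TrivialAction.lean`) with one output; the companion file
`ArithCircuitLabelledEval.lean` proves that it computes `rename TrivAct.wrap P.eval` on at most
`6 (|P| + 1)(A + 1) + |σ|` gates when the gates of `P` have fan-in `≤ A`, and that over
`TrivAct σ` every labelled circuit is symmetric for every group, so that ordinary programs enter
the calculus of symmetric circuits.

## The construction (`ArithCircuit.Labelled.ProgNode`)

Gates: an input gate `inp x` (label `var (wrap x)`) per variable; a constant gate `cst c` per
element of the finite set `progConsts P` of constants used (`0`, `1`, the constant of the output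
operand, the weights and the constant operands of all gates); and for program gate `i < |P|`
with operands `u₀, …, u_{a-1}` and weights `c₀, …, c_{a-1}` (all `1` for a product gate,
`SupportSymm.coeff`):

* `node i`, labelled `+`/`×` like gate `i`, with children `cst (padConst)` and the `term i t`,
  `t < a`, where the pad constant is `0` for a sum and `1` for a product gate (so that nullary
  gates have a child, as Def. 2.2 demands, and keep their value `0`/`1`);
* `term i t`, a `×` gate with the two children `cst cₜ` and `opc i t`;
* `opc i t`, a unary `+` gate over the SOURCE of the operand `uₜ` at level `i`
  (`progSrc P i uₜ`): `inp x` for `var x`, `cst c` for `const c`, `node j` for `gate j` with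
  `j < i`, and `cst 0` for a forward reference `gate j`, `j ≥ i` — the junk value of the list
  semantics.

The copies `term`/`opc` keep repeated operands apart (children form a set, not a list). The
output gate is the source of `P.output` at level `|P|`. Acyclicity by the rank `inp, cst ↦ 0`,
`opc i _ ↦ 3i+1`, `term i _ ↦ 3i+2`, `node i ↦ 3i+3`; input labels are injective because
`TrivAct.wrap` is and there is one constant gate per constant.

## References

* A. Dawar, G. Wilsenach, *Symmetric Arithmetic Circuits*, Theory of Computing 21 (2025),
  Defs. 2.2, 3.6, 3.7. [DawarWilsenach2025]
* P. Bürgisser, *Completeness and Reduction in Algebraic Complexity Theory*, Springer 2000,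
  Def. 2.1. [Burgisser2000]

Everything is folklore and proved; nothing here is a named fact. Decidability is classical
(gates carry constants of `K`).
-/

noncomputable section

open scoped Classical

namespace Literature.Computability.AlgebraicComplexity

open MvPolynomial SupportSymm

universe u v

namespace ArithCircuit

namespace Labelled

variable {K : Type u} {σ : Type v} [CommSemiring K] (P : ArithCircuit K σ)

/-! ### Constants -/

/-- Gate number `i` of the program. [cite: Burgisser2000, Def. 2.1] -/
def gateAt (i : Fin P.size) : Gate K σ := P.gates[(i : ℕ)]'i.2

/-- The constant of an operand, as a finite set (empty for variables and gate references).
[folklore] -/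
def operandConsts : Operand K σ → Finset K
  | .const c => {c}
  | _ => ∅

/-- The pad constant of a gate: the neutral element `0` of a sum gate, `1` of a product gate.
[folklore] -/
def padConst : Gate K σ → K
  | .sum _ => 0
  | .prod _ => 1

/-- The finite set of constants of the labelled circuit of `P`: `0`, `1`, the constant of the
output operand, and the weights and constant operands of all gates. [folklore] -/
def progConsts : Finset K :=
  insert 0 (insert 1 (operandConsts P.output ∪
    Finset.univ.biUnion fun i : Fin P.size =>
      Finset.univ.biUnion fun t : Fin (arity (gateAt P i)) =>
        insert (coeff (gateAt P i) t) (operandConsts (operand (gateAt P i) t))))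

/-- `0 ∈ progConsts`. [folklore] -/
theorem zero_mem_progConsts : (0 : K) ∈ progConsts P := Finset.mem_insert_self _ _

/-- `1 ∈ progConsts`. [folklore] -/
theorem one_mem_progConsts : (1 : K) ∈ progConsts P :=
  Finset.mem_insert_of_mem (Finset.mem_insert_self _ _)

/-- Pad constants are in `progConsts`. [folklore] -/
theorem padConst_mem_progConsts (g : Gate K σ) : padConst g ∈ progConsts P := by
  cases g with
  | sum _ => exact zero_mem_progConsts P
  | prod _ => exact one_mem_progConsts P

/-- Weights are in `progConsts`. [folklore] -/
theorem coeff_mem_progConsts (i : Fin P.size) (t : Fin (arity (gateAt P i))) :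
    coeff (gateAt P i) t ∈ progConsts P := by
  refine Finset.mem_insert_of_mem (Finset.mem_insert_of_mem (Finset.mem_union_right _ ?_))
  refine Finset.mem_biUnion.2 ⟨i, Finset.mem_univ _, ?_⟩
  exact Finset.mem_biUnion.2 ⟨t, Finset.mem_univ _, Finset.mem_insert_self _ _⟩

/-- Constant operands are in `progConsts`. [folklore] -/
theorem mem_progConsts_of_operand_eq (i : Fin P.size) (t : Fin (arity (gateAt P i))) {c : K}
    (h : operand (gateAt P i) t = .const c) : c ∈ progConsts P := by
  refine Finset.mem_insert_of_mem (Finset.mem_insert_of_mem (Finset.mem_union_right _ ?_))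
  refine Finset.mem_biUnion.2 ⟨i, Finset.mem_univ _, ?_⟩
  refine Finset.mem_biUnion.2 ⟨t, Finset.mem_univ _, Finset.mem_insert_of_mem ?_⟩
  rw [h]
  exact Finset.mem_singleton_self c

/-- The constant of a constant output operand is in `progConsts`. [folklore] -/
theorem mem_progConsts_of_output_eq {c : K} (h : P.output = .const c) : c ∈ progConsts P := by
  refine Finset.mem_insert_of_mem (Finset.mem_insert_of_mem (Finset.mem_union_left _ ?_))
  rw [h]
  exact Finset.mem_singleton_self c

omit [CommSemiring K] in
/-- An operand carries at most one constant. [folklore] -/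
theorem card_operandConsts_le (u : Operand K σ) : (operandConsts u).card ≤ 1 := by
  cases u <;> simp [operandConsts]

/-- `|progConsts| ≤ 3 + Σᵢ 2 · arity i`. [folklore] -/
theorem card_progConsts_le :
    (progConsts P).card ≤ 3 + ∑ i : Fin P.size, 2 * arity (gateAt P i) := by
  have hb : ∀ i : Fin P.size,
      ((Finset.univ : Finset (Fin (arity (gateAt P i)))).biUnion fun t =>
        insert (coeff (gateAt P i) t) (operandConsts (operand (gateAt P i) t))).card ≤
        2 * arity (gateAt P i) := fun i =>
    calc ((Finset.univ : Finset (Fin (arity (gateAt P i)))).biUnion fun t =>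
          insert (coeff (gateAt P i) t) (operandConsts (operand (gateAt P i) t))).card
        ≤ ∑ t : Fin (arity (gateAt P i)),
            (insert (coeff (gateAt P i) t) (operandConsts (operand (gateAt P i) t))).card :=
          Finset.card_biUnion_le
      _ ≤ ∑ _t : Fin (arity (gateAt P i)), 2 := Finset.sum_le_sum fun t _ => by
          have h1 := card_operandConsts_le (operand (gateAt P i) t)
          have h2 := Finset.card_insert_le (coeff (gateAt P i) t)
            (operandConsts (operand (gateAt P i) t))
          omega
      _ = 2 * arity (gateAt P i) := by simp [mul_comm]
  have hU : (Finset.univ.biUnion fun i : Fin P.size =>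
      Finset.univ.biUnion fun t : Fin (arity (gateAt P i)) =>
        insert (coeff (gateAt P i) t) (operandConsts (operand (gateAt P i) t))).card ≤
      ∑ i : Fin P.size, 2 * arity (gateAt P i) :=
    le_trans Finset.card_biUnion_le (Finset.sum_le_sum fun i _ => hb i)
  have ho := card_operandConsts_le P.output
  unfold progConsts
  refine le_trans (Finset.card_insert_le _ _) ?_
  refine le_trans (Nat.add_le_add_right (Finset.card_insert_le _ _) 1) ?_
  refine le_trans
    (Nat.add_le_add_right (Nat.add_le_add_right (Finset.card_union_le _ _) 1) 1) ?_
  omega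

/-! ### Gates, wires, labels -/

/-- **Gates of the labelled circuit of a program**: an input gate per variable, a constant gate
per constant used, and for every program gate `i` the node `node i` with, for every operand
position `t`, a multiplication gadget `term i t = cst (weight) × opc i t` over a unary copy
`opc i t` of the operand's source. [cite: DawarWilsenach2025, Def. 2.2] -/
inductive ProgNode (P : ArithCircuit K σ) : Type (max u v)
  /-- Input gate of the variable `x` (label `var (TrivAct.wrap x)`). -/
  | inp (x : σ) : ProgNode P
  /-- Input gate of a constant. -/
  | cst (c : ↥(progConsts P)) : ProgNode P
  /-- The node of program gate `i` (label `+`/`×`). -/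
  | node (i : Fin P.size) : ProgNode P
  /-- The multiplication gadget `weight × operand` of operand `t` of gate `i`. -/
  | term (i : Fin P.size) (t : Fin (arity (gateAt P i))) : ProgNode P
  /-- The unary copy of the source of operand `t` of gate `i`. -/
  | opc (i : Fin P.size) (t : Fin (arity (gateAt P i))) : ProgNode P

/-- The gates as a sum type (for counting). [folklore] -/
def ProgNode.equivSum :
    ProgNode P ≃ σ ⊕ ↥(progConsts P) ⊕ Fin P.size ⊕
      (Σ i : Fin P.size, Fin (arity (gateAt P i))) ⊕
      (Σ i : Fin P.size, Fin (arity (gateAt P i))) where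
  toFun
    | .inp x => Sum.inl x
    | .cst c => Sum.inr (Sum.inl c)
    | .node i => Sum.inr (Sum.inr (Sum.inl i))
    | .term i t => Sum.inr (Sum.inr (Sum.inr (Sum.inl ⟨i, t⟩)))
    | .opc i t => Sum.inr (Sum.inr (Sum.inr (Sum.inr ⟨i, t⟩)))
  invFun
    | Sum.inl x => .inp x
    | Sum.inr (Sum.inl c) => .cst c
    | Sum.inr (Sum.inr (Sum.inl i)) => .node i
    | Sum.inr (Sum.inr (Sum.inr (Sum.inl ⟨i, t⟩))) => .term i t
    | Sum.inr (Sum.inr (Sum.inr (Sum.inr ⟨i, t⟩))) => .opc i t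
  left_inv g := by cases g <;> rfl
  right_inv s := by rcases s with x | c | i | ⟨i, t⟩ | ⟨i, t⟩ <;> rfl

/-- Finitely many gates (for finitely many variables). [folklore] -/
instance ProgNode.instFintype [Fintype σ] : Fintype (ProgNode P) :=
  Fintype.ofEquiv _ (ProgNode.equivSum P).symm

/-- Equality of gates is decided classically (gates carry constants of `K`); pinned so that all
`Finset` operations on gates elaborate alike. [folklore] -/
instance ProgNode.instDecidableEq : DecidableEq (ProgNode P) := Classical.decEq _

/-- **The source of an operand at level `i`**: the variable gate, the constant gate, the node of
an EARLIER gate `j < i` (and `j < |P|`), and the constant gate `0` for a forward or dangling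
reference — the junk value of the list semantics `gateValues` (an unknown constant, which does
not occur in `P`, is also sent to `cst 0`). [cite: Burgisser2000, Def. 2.1] -/
def progSrc (i : ℕ) : Operand K σ → ProgNode P
  | .var x => .inp x
  | .const c =>
    if h : c ∈ progConsts P then .cst ⟨c, h⟩ else .cst ⟨0, zero_mem_progConsts P⟩
  | .gate j =>
    if h : j < i ∧ j < P.size then .node ⟨j, h.2⟩ else .cst ⟨0, zero_mem_progConsts P⟩

/-- **Wires**: inputs have no children; `node i` has the pad constant and the gadgets
`term i t`; `term i t` has the weight constant and the copy `opc i t`; `opc i t` has the source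
of operand `t` at level `i`. [cite: DawarWilsenach2025, Def. 2.2] -/
def progWires : ProgNode P → Finset (ProgNode P)
  | .inp _ => ∅
  | .cst _ => ∅
  | .node i => insert (.cst ⟨padConst (gateAt P i), padConst_mem_progConsts P _⟩)
      (Finset.univ.image fun t => .term i t)
  | .term i t => {.cst ⟨coeff (gateAt P i) t, coeff_mem_progConsts P i t⟩, .opc i t}
  | .opc i t => {progSrc P i (operand (gateAt P i) t)}

/-- The label of the node of a program gate: `+` for a sum gate, `×` for a product gate.
[cite: DawarWilsenach2025, Def. 2.2] -/
def progGateLabel : Gate K σ → CircuitLabel K (TrivAct σ)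
  | .sum _ => .add
  | .prod _ => .mul

/-- **Labels**: `inp x ↦ var (wrap x)`, `cst c ↦ const c`, `node i ↦ +/×`, `term ↦ ×`,
`opc ↦ +`. [cite: DawarWilsenach2025, Def. 2.2] -/
def progLabel : ProgNode P → CircuitLabel K (TrivAct σ)
  | .inp x => .var (TrivAct.wrap x)
  | .cst c => .const c.1
  | .node i => progGateLabel (gateAt P i)
  | .term _ _ => .mul
  | .opc _ _ => .add

/-- Rank, for acyclicity: inputs `0`, `opc i ↦ 3i+1`, `term i ↦ 3i+2`, `node i ↦ 3i+3`.
[folklore] -/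
def progRank : ProgNode P → ℕ
  | .inp _ => 0
  | .cst _ => 0
  | .node i => 3 * i + 3
  | .term i _ => 3 * i + 2
  | .opc i _ => 3 * i + 1

variable {P}

/-- Sources at level `i` have rank `≤ 3 i`. [folklore] -/
theorem progRank_progSrc_le (i : ℕ) (u : Operand K σ) :
    progRank P (progSrc P i u) ≤ 3 * i := by
  cases u with
  | var x => simp [progSrc, progRank]
  | const c => simp only [progSrc]; split_ifs <;> simp [progRank]
  | gate j =>
    simp only [progSrc]
    split_ifs with h
    · simp only [progRank]; omega
    · simp [progRank]

/-- Children have smaller rank. [folklore] -/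
theorem progRank_lt_of_mem_progWires {g h : ProgNode P} (hh : h ∈ progWires P g) :
    progRank P h < progRank P g := by
  cases g with
  | inp x => simp [progWires] at hh
  | cst c => simp [progWires] at hh
  | node i =>
    simp only [progWires, Finset.mem_insert, Finset.mem_image, Finset.mem_univ, true_and] at hh
    rcases hh with rfl | ⟨t, rfl⟩ <;> simp [progRank]
  | term i t =>
    simp only [progWires, Finset.mem_insert, Finset.mem_singleton] at hh
    rcases hh with rfl | rfl <;> simp [progRank]
  | opc i t =>
    simp only [progWires, Finset.mem_singleton] at hh
    subst hh
    have := progRank_progSrc_le (P := P) i (operand (gateAt P i) t)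
    change progRank P _ < 3 * (i : ℕ) + 1
    omega

omit [CommSemiring K] in
/-- The label of a node is never an input label. [folklore] -/
theorem not_isInput_progGateLabel (g : Gate K σ) : ¬ (progGateLabel g).IsInput := by
  cases g <;> simp [progGateLabel]

/-- Input labels exactly at the gates without children. [cite: DawarWilsenach2025, Def. 2.2] -/
theorem isInput_progLabel_iff (g : ProgNode P) :
    (progLabel P g).IsInput ↔ progWires P g = ∅ := by
  cases g with
  | inp x => simp [progLabel, progWires]
  | cst c => simp [progLabel, progWires]
  | node i => simp [progLabel, not_isInput_progGateLabel, progWires]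
  | term i t => simp [progLabel, progWires]
  | opc i t => simp [progLabel, progWires]

/-- Labels are injective on input gates (`wrap` is injective; one constant gate per constant).
[cite: DawarWilsenach2025, Def. 2.2] -/
theorem eq_of_progLabel_eq (g g' : ProgNode P) (hg : (progLabel P g).IsInput)
    (h : progLabel P g = progLabel P g') : g = g' := by
  cases g with
  | inp x =>
    cases g' with
    | inp x' =>
      simp only [progLabel, CircuitLabel.var.injEq] at h
      rw [TrivAct.wrap_injective h]
    | cst c => simp [progLabel] at h
    | node i => exact absurd (h ▸ hg) (not_isInput_progGateLabel _)
    | term i t => simp [progLabel] at h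
    | opc i t => simp [progLabel] at h
  | cst c =>
    cases g' with
    | inp x' => simp [progLabel] at h
    | cst c' => simp only [progLabel, CircuitLabel.const.injEq] at h; rw [Subtype.ext h]
    | node i => exact absurd (h ▸ hg) (not_isInput_progGateLabel _)
    | term i t => simp [progLabel] at h
    | opc i t => simp [progLabel] at h
  | node i => exact absurd hg (not_isInput_progGateLabel _)
  | term i t => simp [progLabel] at hg
  | opc i t => simp [progLabel] at hg

variable (P)

/-- **The labelled circuit of the program `P`** (Dawar–Wilsenach Def. 2.2) over the variables
`TrivAct σ`, with the single output the source of `P.output` at level `|P|`.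
[cite: DawarWilsenach2025, Def. 2.2] -/
def progCircuit : LabelledArithCircuit K (TrivAct σ) Unit (ProgNode P) where
  children := progWires P
  label := progLabel P
  output := fun _ => progSrc P P.size P.output
  wf := Subrelation.wf (fun {_ _} hh => progRank_lt_of_mem_progWires hh)
    (InvImage.wf (progRank P) Nat.lt_wfRel.wf)
  isInput_iff := isInput_progLabel_iff
  eq_of_label_eq := eq_of_progLabel_eq
  output_injective := fun a b _ => Subsingleton.elim a b

/-- The output gate is the source of `P.output` at level `|P|`.
[cite: DawarWilsenach2025, Def. 2.2] -/
theorem progCircuit_output (y : Unit) :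
    (progCircuit P).output y = progSrc P P.size P.output := rfl

omit [CommSemiring K] in
/-- The number of gadgets `term i t` of a node is the arity of the gate, at most the fan-in
bound. [folklore] -/
theorem arity_gateAt_le {A : ℕ} (hA : ∀ g ∈ P.gates, g.fanIn ≤ A) (i : Fin P.size) :
    arity (gateAt P i) ≤ A := by
  rw [arity_eq_length_args]
  exact hA _ (List.getElem_mem i.2)

end Labelled

end ArithCircuit

end Literature.Computability.AlgebraicComplexity

end
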